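import Literature.NumberTheory.LFunctions.CertifiedDirichletLTuringBooker
import Literature.NumberTheory.LFunctions.ZetaLogDerivRealBound
import HarnessLib

/-!
# Trudgian 2011, Theorem 3.8 for Dirichlet `L`-functions — proved (discharge of `trudgian2011_theorem38`)

T. S. Trudgian, *Improvements to Turing's method*, Math. Comp. **80** (2011) 2259–2279, §3 Theorem 3.8
with the constants (3.17)–(3.18) VERBATIM (`Trudgian2011Dirichlet.aConst`, `.bConst` of
`CertifiedDirichletLTuringTrudgian.lean`): for `χ` primitive of conductor `Q > 1`, `1 < c ≤ 5/4`,
`½ < d ≤ 1` and `50 < t₀ < t₁ < t₂`,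

  `|∫_{t₁}^{t₂} S(t, χ) dt| ≤ a(c, d, t₀) + b(c, d) log(Qt₂/2π)`.

Main result: `trudgian2011_theorem38_holds : trudgian2011_theorem38`.

The tree already proves Theorem 3.8 for one character in the SHAPE `π|∫S| ≤ (a₁+a₂) + (b₁+b₂) log(Qt₂/2π)`
(`TuringDirichlet.abs_pi_mul_integral_lfunctionArgS_le_hadamard`, `CertifiedDirichletLTuringHadamardSingle.lean`:
Littlewood's lemma 3.4, Rademacher's Lemma 3.5/3.6, Lemma 3.7 via the genus-one Hadamard product and
Booker's inequality = Trudgian's Lemma 2.10), but with the `Γ`-factor handled by the FIRST-order vertical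
Stirling bound (`turingEps(t) = 3/(2t²) + π/(4t)`, `turingEps'`), whose `π/(4t)` exceeds the printed error
budget `15d²/t₀²` of (3.17).  This file redoes the two `Γ`-steps of Lemma 3.7 with the tree's SECOND-order
Stirling bound `|Re ψ(w) − log‖w‖ + Re 1/(2w)| ≤ 1/(6|Im w|³) + π/(12 Im w²)`
(`Booker2006Turing.abs_re_digamma_half_sub_le`), which is what the source's Lemma 2.8 / mean-value
treatment amounts to:

* `re_logDeriv_dirichletXi_sub_ge₂`: `Re(ξ'/ξ − L'/L)(x+it,χ) ≥ ½ log(Qt/2π) − e_a(t)`,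
  `e_a(t) = 7/(4t²) + 2/(3t³) + π/(6t²)`, `x ∈ [½, 5/2]` (the `(d²/2) log(Q/π) + I₁` terms);
* `re_logDeriv_dirichletXi_sub_le₂`: `Re(ξ'/ξ − L'/L)(½+d+it,χ) ≤ ½ log(Qt/2π) + e_b(t)`,
  `e_b(t) = 25/(16t²) + 2/(3t³) + π/(6t²)` (the `ε'` of the bound for `Re ξ'/ξ(½+d+it)`);
* `neg_setIntegral_log_norm_LFunction_le₂`: Lemma 3.7 with these errors (decomposition, `I(d)` and the
  zeros' part `TuringDirichlet.integral_log_norm_dirichletXi_sub_shift_ge` from the tree; Booker's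
  `Re L'/L ≤ 2ζ'/ζ(1+2d) − ζ'/ζ(½+d)`, (4–11));
* `pi_mul_integral_lfunctionArgS_le₂` / `neg_…` / `abs_integral_lfunctionArgS_le_aConst_of_ne`: Theorem 3.8
  at non-ordinates `50 < t₀ < t₁ ≤ t₂`, then `secondOrderConst_le_pi_mul_aConst`: the second-order constant
  is `≤ π a(c,d,t₀)` — `2ζ'/ζ(1+2d) ≤ 0` dropped as in print (`−d²(log 4) ζ'/ζ(½+d)` is (3.17)'s term;
  `ζ'/ζ` real on `(1,∞)`), `I(d)` respelled with `logZeta` (`turingI_eq_logZeta`), and the error terms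
  `729/(2048t₀²) + d² log 4 · e_b(t₀) + d² e_a(t₀) ≤ 6.7 d²/t₀² ≤ 15d²/t₀²` (`error_le_fifteen`);
  `b₁ + b₂ = π b(c,d)` on the nose;
* `abs_integral_lfunctionArgS_le_aConst`: the typed fact has no "not an ordinate" proviso — both sides
  are continuous in `t₁`, `t₂` (`S_χ` is locally integrable,
  `Booker2006Turing.intervalIntegrable_lfunctionArgS_of_isPrimitive`) and non-ordinates are dense, as in
  `CertifiedDirichletLTuringBooker.lean`.

Everything is a theorem (standard axioms); no new definition, no named fact.  The numerical instances
`trudgian2011_theorem33` (`(c,d) = (1.17, 0.88)`: `1.975 + 0.084 log`) and `platt2016_theorem54`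
(`(1.1, 0.8)`: `2.17618 + 0.0679956 log`) follow from this theorem and a certified evaluation of (3.17)
(`∫ log ζ`, `ζ'/ζ(½+d)`), which is NOT done here.

## References
* T. S. Trudgian, Improvements to Turing's method, Math. Comp. 80 (2011), §3.4 Lemmas 3.6–3.7 and
  Theorem 3.8 with (3.17)–(3.18), p. 2273 (arXiv:0903.1885 pp. 9–10). [Trudgian2011]
* R. Rumely, Numerical computations concerning the ERH, Math. Comp. 61 (1993), (22)–(24) p. 432,
  Lemma 3 p. 429. [Rumely1993ERH]
* A. R. Booker, Experiment. Math. 15 (2006), §4 Lemma 4.5 (4–11). [Booker2006]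
-/

noncomputable section

open Complex Set MeasureTheory intervalIntegral Filter Topology
open scoped Real

namespace Literature.NumberTheory.LFunctions

open DirichletTheta DirichletCharacter ExplicitPsiChar Trudgian2011Dirichlet Booker2006Turing

namespace TuringDirichlet

variable {q : ℕ} [NeZero q] {χ : DirichletCharacter ℂ q}

/-! ### Second-order Stirling for the non-`L` part of `ξ'/ξ(s, χ)` -/

/-- **Lower bound, second order:** for `χ ≠ 1`, `½ ≤ x ≤ 5/2`, `t ≥ 1`, `L(x + it, χ) ≠ 0`,
`Re (ξ'/ξ − L'/L)(x + it, χ) = ½ log(Q/π) + ½ Re ψ((x+a+it)/2)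
   ≥ ½ log Q + ½ log t − ½ log 2 − ½ log π − (7/(4t²) + 2/(3t³) + π/(6t²))`
(Trudgian, §3.4: the `(d²/2) log(Q/π) + I₁` terms before integration, his Lemma 2.8 / mean-value step
replaced by the pointwise second-order Stirling bound of the tree,
`|Re ψ(w) − log‖w‖ + Re 1/(2w)| ≤ 1/(6|Im w|³) + π/(12 Im w²)`).
[cite: Trudgian2011, §3.4 proof of Lemma 3.7] [cite: Rumely1993ERH, (22)–(24) p. 432] -/
theorem re_logDeriv_dirichletXi_sub_ge₂ (h1 : χ ≠ 1) {x t : ℝ} (hx : 1 / 2 ≤ x) (hx' : x ≤ 5 / 2)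
    (ht : 1 ≤ t) (hL : χ.LFunction (x + t * I) ≠ 0) :
    Real.log q / 2 + Real.log t / 2 - Real.log 2 / 2 - Real.log π / 2 -
        (7 / (4 * t ^ 2) + (2 / (3 * t ^ 3) + π / (6 * t ^ 2))) ≤
      (deriv (dirichletXi χ) (x + t * I) / dirichletXi χ (x + t * I)).re -
        (deriv χ.LFunction (x + t * I) / χ.LFunction (x + t * I)).re := by
  have ht0 : 0 < t := by linarith
  have ha0 : (0 : ℝ) ≤ charParity χ := Nat.cast_nonneg _
  have ha1 : (charParity χ : ℝ) ≤ 1 := by exact_mod_cast charParity_le_one χ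
  rw [re_logDeriv_dirichletXi_sub_eq h1 (by simp; linarith) hL]
  have hS := abs_re_digamma_half_sub_le (x := x) (t := t) (a := charParity χ) (by linarith) ht0.ne'
  rw [abs_of_pos ht0] at hS
  have hS' := (abs_le.mp hS).1
  -- `log‖x + a + it‖ ≥ log t`
  have hnorm : t ≤ ‖(x : ℂ) + t * I + (charParity χ : ℕ)‖ := by
    have h := abs_im_le_norm ((x : ℂ) + t * I + (charParity χ : ℕ))
    simp only [add_im, ofReal_im, mul_im, ofReal_re, I_im, I_re, natCast_im, mul_one, mul_zero,
      zero_add, add_zero, abs_of_pos ht0] at h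
    exact h
  have hlog : Real.log t ≤ Real.log ‖(x : ℂ) + t * I + (charParity χ : ℕ)‖ :=
    Real.log_le_log ht0 hnorm
  -- `(x+a)/((x+a)² + t²) ≤ 7/(2t²)`
  have hD : t ^ 2 ≤ (x + charParity χ) ^ 2 + t ^ 2 := by nlinarith
  have hfrac : (x + charParity χ) / ((x + charParity χ) ^ 2 + t ^ 2) ≤ 7 / 2 / t ^ 2 := by
    calc (x + charParity χ) / ((x + charParity χ) ^ 2 + t ^ 2)
        ≤ (x + charParity χ) / t ^ 2 := div_le_div_of_nonneg_left (by linarith) (by positivity) hD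
      _ ≤ 7 / 2 / t ^ 2 := div_le_div_of_nonneg_right (by linarith) (by positivity)
  have e7 : (7 : ℝ) / 2 / t ^ 2 = 2 * (7 / (4 * t ^ 2)) := by field_simp; ring
  have eB : 4 / (3 * t ^ 3) + π / (3 * t ^ 2) = 2 * (2 / (3 * t ^ 3) + π / (6 * t ^ 2)) := by ring
  rw [e7] at hfrac
  rw [eB] at hS'
  linarith

/-- **Upper bound at `x = ½ + d`, second order:** for `χ ≠ 1`, `½ < d ≤ 1`, `t ≥ 1`,
`Re (ξ'/ξ − L'/L)(½ + d + it, χ) ≤ ½ log Q + ½ log t − ½ log 2 − ½ log π + (25/(16t²) + 2/(3t³) + π/(6t²))`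
(Trudgian's `ε'` step in the bound for `Re ξ'/ξ(½ + d + it)`; `log‖u + it‖ ≤ log t + u²/(2t²)`, `u ≤ 5/2`).
[cite: Trudgian2011, §3.4 proof of Lemma 3.7 (displays before Lemma 3.7)] -/
theorem re_logDeriv_dirichletXi_sub_le₂ (h1 : χ ≠ 1) {d t : ℝ} (hd : 1 / 2 < d) (hd1 : d ≤ 1)
    (ht : 1 ≤ t) :
    (deriv (dirichletXi χ) (((1 / 2 + d : ℝ) : ℂ) + t * I) /
          dirichletXi χ (((1 / 2 + d : ℝ) : ℂ) + t * I)).re -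
        (deriv χ.LFunction (((1 / 2 + d : ℝ) : ℂ) + t * I) /
          χ.LFunction (((1 / 2 + d : ℝ) : ℂ) + t * I)).re ≤
      Real.log q / 2 + Real.log t / 2 - Real.log 2 / 2 - Real.log π / 2 +
        (25 / (16 * t ^ 2) + (2 / (3 * t ^ 3) + π / (6 * t ^ 2))) := by
  have ht0 : 0 < t := by linarith
  have ha0 : (0 : ℝ) ≤ charParity χ := Nat.cast_nonneg _
  have ha1 : (charParity χ : ℝ) ≤ 1 := by exact_mod_cast charParity_le_one χ
  have hL : χ.LFunction (((1 / 2 + d : ℝ) : ℂ) + t * I) ≠ 0 :=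
    LFunction_ne_zero_of_one_le_re χ (Or.inl h1) (by simp; linarith)
  rw [re_logDeriv_dirichletXi_sub_eq h1 (by simp; linarith) hL]
  have hS := abs_re_digamma_half_sub_le (x := 1 / 2 + d) (t := t) (a := charParity χ) (by linarith)
    ht0.ne'
  rw [abs_of_pos ht0] at hS
  have hS' := (abs_le.mp hS).2
  set u : ℝ := 1 / 2 + d + charParity χ with hu
  have hu0 : 0 < u := by rw [hu]; linarith
  have hu5 : u ≤ 5 / 2 := by rw [hu]; linarith
  -- `log‖u + it‖ ≤ log t + u²/(2t²)`
  have hN : ‖((1 / 2 + d : ℝ) : ℂ) + t * I + (charParity χ : ℕ)‖ ^ 2 = u ^ 2 + t ^ 2 := by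
    rw [Complex.sq_norm, normSq_apply]; simp [hu]; ring
  have hlog : Real.log ‖((1 / 2 + d : ℝ) : ℂ) + t * I + (charParity χ : ℕ)‖ ≤
      Real.log t + u ^ 2 / (2 * t ^ 2) := by
    have hpos : 0 < ‖((1 / 2 + d : ℝ) : ℂ) + t * I + (charParity χ : ℕ)‖ := by
      have : t ≤ ‖((1 / 2 + d : ℝ) : ℂ) + t * I + (charParity χ : ℕ)‖ := by
        have h := abs_im_le_norm (((1 / 2 + d : ℝ) : ℂ) + t * I + (charParity χ : ℕ))
        simp only [add_im, ofReal_im, mul_im, ofReal_re, I_im, I_re, natCast_im, mul_one, mul_zero,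
          zero_add, add_zero, abs_of_pos ht0] at h
        exact h
      linarith
    have e1 : Real.log ‖((1 / 2 + d : ℝ) : ℂ) + t * I + (charParity χ : ℕ)‖ =
        Real.log (u ^ 2 + t ^ 2) / 2 := by
      rw [← hN, Real.log_pow]; push_cast; ring
    have e2 : Real.log t = Real.log (t ^ 2) / 2 := by
      rw [Real.log_pow]; push_cast; ring
    rw [e1, e2]
    have ht2 : 0 < t ^ 2 := by positivity
    have h := Real.log_le_sub_one_of_pos (div_pos (by positivity : 0 < u ^ 2 + t ^ 2) ht2)
    rw [Real.log_div (by positivity) ht2.ne'] at h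
    have e3 : (u ^ 2 + t ^ 2) / t ^ 2 - 1 = u ^ 2 / t ^ 2 := by field_simp; ring
    rw [e3] at h
    have e4 : u ^ 2 / (2 * t ^ 2) = u ^ 2 / t ^ 2 / 2 := by rw [div_div, mul_comm]
    rw [e4]
    linarith
  have hsq : u ^ 2 / (2 * t ^ 2) ≤ 25 / (16 * t ^ 2) * 2 := by
    rw [div_le_iff₀ (by positivity)]
    have : u ^ 2 ≤ 25 / 4 := by nlinarith
    have e : 25 / (16 * t ^ 2) * 2 * (2 * t ^ 2) = 25 / 4 := by field_simp; ring
    linarith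
  have hfrac : 0 ≤ (1 / 2 + d + (charParity χ : ℝ)) / ((1 / 2 + d + charParity χ) ^ 2 + t ^ 2) := by
    positivity
  have eB : 4 / (3 * t ^ 3) + π / (3 * t ^ 2) = 2 * (2 / (3 * t ^ 3) + π / (6 * t ^ 2)) := by ring
  rw [eB] at hS'
  linarith

/-! ### The first integral of Trudgian's decomposition, second order -/

/-- `L(x + it, χ) ≠ 0` for `x ≥ ½` when `t` is the ordinate of no non-trivial zero. [folklore] -/
private theorem LFunction_ne_zero_of_half_le₂ (h1 : χ ≠ 1) {t : ℝ}
    (ht : ∀ ρ ∈ charNontrivialZeros χ, ρ.im ≠ t) {x : ℝ} (hx : 1 / 2 ≤ x) :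
    χ.LFunction (x + t * I) ≠ 0 := by
  intro hL
  rcases lt_or_ge x 1 with hx1 | hx1
  · exact ht _ (mem_charNontrivialZeros.2 ⟨hL, by simp; linarith, by simpa using hx1⟩) (by simp)
  · exact LFunction_ne_zero_of_one_le_re χ (Or.inl h1) (by simpa using hx1) hL

/-- `σ ↦ log|L(σ + it, χ)|` is interval integrable on `[a, b]`, `½ ≤ a, b`. [folklore] -/
private theorem intervalIntegrable_log_norm_LFunction₂ (h1 : χ ≠ 1) {t a b : ℝ}
    (ht : ∀ ρ ∈ charNontrivialZeros χ, ρ.im ≠ t) (ha : 1 / 2 ≤ a) (hb : 1 / 2 ≤ b) :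
    IntervalIntegrable (fun x : ℝ ↦ Real.log ‖χ.LFunction (x + t * I)‖) volume a b := by
  have h := integrableOn_log_norm_LFunction h1 ht
  have key : ∀ a b : ℝ, 1 / 2 ≤ a → a ≤ b →
      IntervalIntegrable (fun x : ℝ ↦ Real.log ‖χ.LFunction (x + t * I)‖) volume a b :=
    fun a b ha hab ↦ (intervalIntegrable_iff_integrableOn_Ioc_of_le hab).2
      (h.mono_set fun x hx ↦ lt_of_le_of_lt ha hx.1)
  rcases le_total a b with hab | hab
  · exact key a b ha hab
  · exact (key b a hb hab).symm

/-- `σ ↦ log|ξ(σ + it, χ)|` is continuous (`t` not an ordinate). [folklore] -/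
private theorem continuous_log_norm_dirichletXi₂ (hχ : χ.IsPrimitive) (h1 : χ ≠ 1) {t : ℝ}
    (hord : ∀ ρ ∈ charNontrivialZeros χ, ρ.im ≠ t) :
    Continuous fun x : ℝ ↦ Real.log ‖dirichletXi χ (x + t * I)‖ := by
  have hξ : ∀ x : ℝ, dirichletXi χ (x + t * I) ≠ 0 := fun x ↦
    dirichletXi_ne_zero_of_im_eq hχ h1 hord (by simp)
  have hc : Continuous fun x : ℝ ↦ dirichletXi χ (x + t * I) :=
    (differentiable_dirichletXi h1).continuous.comp (by fun_prop)
  exact continuous_iff_continuousAt.2 fun x ↦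
    (hc.continuousAt.norm).log (norm_ne_zero_iff.2 (hξ x))

/-- **Per-abscissa form** (cf. `log_norm_LFunction_sub_shift_ge`, with the second-order error): for
`½ ≤ σ`, `0 ≤ d`, `σ + d ≤ 3/2`, `t ≥ 1` not an ordinate,
`log|L(s)| − log|L(s+d)| ≥ [log|ξ(s,χ)| − log|ξ(s+d,χ)|] + d(½ log Q + ½ log t − ½ log 2π − e_a(t))`,
`e_a(t) = 7/(4t²) + 2/(3t³) + π/(6t²)`. [cite: Trudgian2011, §3.4 proof of Lemma 3.7] -/
theorem log_norm_LFunction_sub_shift_ge₂ (hχ : χ.IsPrimitive) (h1 : χ ≠ 1) {σ d t : ℝ}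
    (hσ : 1 / 2 ≤ σ) (hd : 0 ≤ d) (hσd2 : σ + d ≤ 5 / 2) (ht : 1 ≤ t)
    (hord : ∀ ρ ∈ charNontrivialZeros χ, ρ.im ≠ t) :
    (Real.log ‖dirichletXi χ (σ + t * I)‖ - Real.log ‖dirichletXi χ ((σ + d : ℝ) + t * I)‖) +
      d * (Real.log q / 2 + Real.log t / 2 - Real.log 2 / 2 - Real.log π / 2 -
        (7 / (4 * t ^ 2) + (2 / (3 * t ^ 3) + π / (6 * t ^ 2)))) ≤
    Real.log ‖χ.LFunction (σ + t * I)‖ - Real.log ‖χ.LFunction ((σ + d : ℝ) + t * I)‖ := by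
  have hL : ∀ x : ℝ, 1 / 2 ≤ x → χ.LFunction (x + t * I) ≠ 0 := fun x hx ↦
    LFunction_ne_zero_of_half_le₂ h1 hord hx
  have hξ : ∀ x : ℝ, dirichletXi χ (x + t * I) ≠ 0 := fun x ↦
    dirichletXi_ne_zero_of_im_eq hχ h1 hord (by simp)
  have hLa : ∀ x ∈ Icc σ (σ + d), AnalyticAt ℂ χ.LFunction (x + t * I) := fun x _ ↦
    (differentiable_LFunction h1).analyticAt _
  have hξa : ∀ x ∈ Icc σ (σ + d), AnalyticAt ℂ (dirichletXi χ) (x + t * I) := fun x _ ↦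
    (differentiable_dirichletXi h1).analyticAt _
  have hσd : σ ≤ σ + d := by linarith
  have hL' : ∀ x ∈ Icc σ (σ + d), χ.LFunction (x + t * I) ≠ 0 := fun x hx ↦ hL x (hσ.trans hx.1)
  have FL := integral_re_logDeriv_horizontal hσd hLa hL'
  have Fξ := integral_re_logDeriv_horizontal hσd hξa (fun x _ ↦ hξ x)
  have IL := (continuousOn_re_logDeriv_horizontal hLa hL').intervalIntegrable_of_Icc
    (μ := volume) hσd
  have Iξ := (continuousOn_re_logDeriv_horizontal hξa (fun x _ ↦ hξ x)).intervalIntegrable_of_Icc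
    (μ := volume) hσd
  set c : ℝ := Real.log q / 2 + Real.log t / 2 - Real.log 2 / 2 - Real.log π / 2 -
    (7 / (4 * t ^ 2) + (2 / (3 * t ^ 3) + π / (6 * t ^ 2))) with hc
  have hpt : ∀ x ∈ Icc σ (σ + d), c ≤
      (deriv (dirichletXi χ) (x + t * I) / dirichletXi χ (x + t * I)).re -
        (deriv χ.LFunction (x + t * I) / χ.LFunction (x + t * I)).re :=
    fun x hx ↦ re_logDeriv_dirichletXi_sub_ge₂ h1 (hσ.trans hx.1) (by linarith [hx.2]) ht (hL' x hx)
  have hmono := intervalIntegral.integral_mono_on hσd intervalIntegrable_const (Iξ.sub IL) hpt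
  rw [intervalIntegral.integral_const, intervalIntegral.integral_sub Iξ IL, FL, Fξ, smul_eq_mul]
    at hmono
  have e : (σ + d - σ) * c = d * c := by ring
  rw [e] at hmono
  push_cast at hmono ⊢
  linarith

/-- **Integrated form** (cf. `integral_log_norm_LFunction_sub_shift_ge`): for `0 ≤ d ≤ 1`, `t ≥ 1` not
an ordinate, `χ` primitive mod `Q > 1`,
`∫_{1/2}^{1/2+d} (log|L(σ+it)| − log|L(σ+d+it)|) dσ
   ≥ ∫_{1/2}^{1/2+d} (log|ξ(σ+it,χ)| − log|ξ(σ+d+it,χ)|) dσ + d²(½ log(Qt/2π) − e_a(t))`.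
[cite: Trudgian2011, §3.4 proof of Lemma 3.7] -/
theorem integral_log_norm_LFunction_sub_shift_ge₂ (hχ : χ.IsPrimitive) (h1 : χ ≠ 1) {d t : ℝ}
    (hd : 0 ≤ d) (hd1 : d ≤ 1) (ht : 1 ≤ t) (hord : ∀ ρ ∈ charNontrivialZeros χ, ρ.im ≠ t) :
    (∫ σ in (1 / 2 : ℝ)..(1 / 2 + d),
        (Real.log ‖dirichletXi χ (σ + t * I)‖ -
          Real.log ‖dirichletXi χ ((σ + d : ℝ) + t * I)‖)) +
      d ^ 2 * (Real.log q / 2 + Real.log t / 2 - Real.log 2 / 2 - Real.log π / 2 -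
        (7 / (4 * t ^ 2) + (2 / (3 * t ^ 3) + π / (6 * t ^ 2)))) ≤
    ∫ σ in (1 / 2 : ℝ)..(1 / 2 + d),
        (Real.log ‖χ.LFunction (σ + t * I)‖ - Real.log ‖χ.LFunction ((σ + d : ℝ) + t * I)‖) := by
  set c : ℝ := Real.log q / 2 + Real.log t / 2 - Real.log 2 / 2 - Real.log π / 2 -
    (7 / (4 * t ^ 2) + (2 / (3 * t ^ 3) + π / (6 * t ^ 2))) with hc
  have hle : (1 / 2 : ℝ) ≤ 1 / 2 + d := by linarith
  have I1 : IntervalIntegrable (fun σ : ℝ ↦ Real.log ‖χ.LFunction (σ + t * I)‖) volume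
      (1 / 2) (1 / 2 + d) := intervalIntegrable_log_norm_LFunction₂ h1 hord le_rfl hle
  have I2 : IntervalIntegrable (fun σ : ℝ ↦ Real.log ‖χ.LFunction ((σ + d : ℝ) + t * I)‖) volume
      (1 / 2) (1 / 2 + d) := by
    have h := (intervalIntegrable_log_norm_LFunction₂ h1 hord hle (b := 1 / 2 + d + d)
      (by linarith)).comp_add_right d
    simp only [add_sub_cancel_right] at h
    exact h
  have hξc := continuous_log_norm_dirichletXi₂ hχ h1 hord
  have I3 : IntervalIntegrable (fun σ : ℝ ↦ Real.log ‖dirichletXi χ (σ + t * I)‖ -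
      Real.log ‖dirichletXi χ ((σ + d : ℝ) + t * I)‖) volume (1 / 2) (1 / 2 + d) :=
    (hξc.intervalIntegrable _ _).sub ((hξc.comp (continuous_id.add continuous_const :
      Continuous fun σ : ℝ ↦ σ + d)).intervalIntegrable _ _)
  have hpt : ∀ σ ∈ Icc (1 / 2 : ℝ) (1 / 2 + d),
      (Real.log ‖dirichletXi χ (σ + t * I)‖ - Real.log ‖dirichletXi χ ((σ + d : ℝ) + t * I)‖) +
        d * c ≤
      Real.log ‖χ.LFunction (σ + t * I)‖ - Real.log ‖χ.LFunction ((σ + d : ℝ) + t * I)‖ :=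
    fun σ hσ ↦ log_norm_LFunction_sub_shift_ge₂ hχ h1 hσ.1 hd (by linarith [hσ.2]) ht hord
  have hmono := intervalIntegral.integral_mono_on hle (I3.add intervalIntegrable_const) (I1.sub I2)
    hpt
  rw [intervalIntegral.integral_add I3 intervalIntegrable_const, intervalIntegral.integral_const,
    smul_eq_mul] at hmono
  have e : (1 / 2 + d - 1 / 2) * (d * c) = d ^ 2 * c := by ring
  rw [e] at hmono
  exact hmono

/-! ### Lemma 3.7 with second-order error terms -/

/-- **Trudgian 2011, Lemma 3.7, for one primitive character, with error terms `O(d²/t²)`:** for `χ`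
primitive modulo `Q > 1`, `½ < d ≤ 1`, `t ≥ 1` not an ordinate,
`−∫_{1/2}^∞ log|L(σ+it,χ)| dσ ≤ d² log 4 (2ζ'/ζ(1+2d) − ζ'/ζ(½+d) + ½ log(Qt/2π) + e_b(t))
   − d²(½ log(Qt/2π) − e_a(t)) − I(d)`,
`e_a(t) = 7/(4t²) + 2/(3t³) + π/(6t²)`, `e_b(t) = 25/(16t²) + 2/(3t³) + π/(6t²)` (the tree's
`neg_setIntegral_log_norm_LFunction_le` with the second-order Stirling bounds above in place of
`turingEps`, `turingEps'`; zeros' part `integral_log_norm_dirichletXi_sub_shift_ge`).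
[cite: Trudgian2011, §3.4 Lemma 3.7] -/
theorem neg_setIntegral_log_norm_LFunction_le₂ (hq : 1 < q) (hχ : χ.IsPrimitive) {d t : ℝ}
    (hd : 1 / 2 < d) (hd1 : d ≤ 1) (ht : 1 ≤ t) (hz : ∀ ρ ∈ charNontrivialZeros χ, ρ.im ≠ t) :
    -(∫ σ in Ioi (1 / 2 : ℝ), Real.log ‖χ.LFunction (σ + t * I)‖) ≤
      d ^ 2 * Real.log 4 *
          ((2 * (deriv riemannZeta (2 * (1 / 2 + d) : ℝ) / riemannZeta (2 * (1 / 2 + d) : ℝ)).re -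
              (deriv riemannZeta (1 / 2 + d : ℝ) / riemannZeta (1 / 2 + d : ℝ)).re) +
            Real.log q / 2 + Real.log t / 2 - Real.log 2 / 2 - Real.log π / 2 +
            (25 / (16 * t ^ 2) + (2 / (3 * t ^ 3) + π / (6 * t ^ 2)))) -
        d ^ 2 * (Real.log q / 2 + Real.log t / 2 - Real.log 2 / 2 - Real.log π / 2 -
          (7 / (4 * t ^ 2) + (2 / (3 * t ^ 3) + π / (6 * t ^ 2)))) -
        turingI d := by
  have hq1 : q ≠ 1 := by omega
  have h1 : χ ≠ 1 := SelbergDirichlet.ne_one_of_isPrimitive hq1 hχ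
  have hdec := setIntegral_Ioi_half_log_norm_LFunction_eq_decomp h1 (by linarith : (0:ℝ) ≤ d) hz
    (t := t)
  have hA := integral_log_norm_LFunction_sub_shift_ge₂ hχ h1 (by linarith : (0:ℝ) ≤ d) hd1 ht hz
  have hJ₁ := intervalIntegral_log_norm_LFunction_ge h1 hd hz
  have hJ₂ := setIntegral_Ioi_log_norm_LFunction_ge h1 hd hz
  have hZ := integral_log_norm_dirichletXi_sub_shift_ge hχ h1 hd hd1 hz (t := t)
  -- `Re ξ'/ξ(½ + d + it) ≤ ζ-terms + ½ log(Qt/2π) + e_b`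
  have hre1 : 1 < (1 / 2 + d : ℝ) := by linarith
  have hLb := Booker2006Turing.re_logDeriv_LFunction_le χ hre1 t
  have hR := re_logDeriv_dirichletXi_sub_le₂ h1 hd hd1 ht (χ := χ) (t := t)
  have hlog4 : 0 ≤ d ^ 2 * Real.log 4 := by
    have := Real.log_nonneg (by norm_num : (1:ℝ) ≤ 4); positivity
  have hRle : (deriv (dirichletXi χ) (((1 / 2 + d : ℝ) : ℂ) + t * I) /
        dirichletXi χ (((1 / 2 + d : ℝ) : ℂ) + t * I)).re ≤
      (2 * (deriv riemannZeta (2 * (1 / 2 + d) : ℝ) / riemannZeta (2 * (1 / 2 + d) : ℝ)).re -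
          (deriv riemannZeta (1 / 2 + d : ℝ) / riemannZeta (1 / 2 + d : ℝ)).re) +
        Real.log q / 2 + Real.log t / 2 - Real.log 2 / 2 - Real.log π / 2 +
        (25 / (16 * t ^ 2) + (2 / (3 * t ^ 3) + π / (6 * t ^ 2))) := by linarith
  have hRR := mul_le_mul_of_nonneg_left hRle hlog4
  simp only [turingI]
  rw [hdec]
  linarith

/-! ### Theorem 3.8 for one character with second-order error terms, at non-ordinates -/

omit [NeZero q] in
/-- `log(Qt/2π) = log Q + log t − log 2 − log π`. [folklore] -/
private theorem log_qt_eq₂ (hq : 0 < (q : ℝ)) {t : ℝ} (ht : 0 < t) :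
    Real.log (q * t / (2 * π)) = Real.log q + Real.log t - Real.log 2 - Real.log π := by
  rw [Real.log_div (by positivity) (by positivity), Real.log_mul hq.ne' ht.ne',
    Real.log_mul two_ne_zero Real.pi_ne_zero]
  ring

/-- Monotonicity of the error terms: `c/t^k` decreases. [folklore] -/
private theorem err_mono {t₀ t : ℝ} (h0 : 0 < t₀) (h : t₀ ≤ t) (a b : ℝ) (ha : 0 ≤ a) (hb : 0 ≤ b) :
    a / (b * t ^ 2) + (2 / (3 * t ^ 3) + π / (6 * t ^ 2)) ≤
      a / (b * t₀ ^ 2) + (2 / (3 * t₀ ^ 3) + π / (6 * t₀ ^ 2)) := by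
  have ht : 0 < t := lt_of_lt_of_le h0 h
  have h2 : t₀ ^ 2 ≤ t ^ 2 := by nlinarith
  have h3 : t₀ ^ 3 ≤ t ^ 3 := by nlinarith
  rcases eq_or_lt_of_le hb with hb0 | hb0
  · rw [← hb0]; simp
    gcongr
  · gcongr

/-- **One-sided bound, second order** (Lemma 3.6 at `v`, Lemma 3.7 at `u`; `t₀ < u`, `t₀ < v`
non-ordinates, `t₀ ≥ 1`): `U_χ(v) − U_χ(u) ≤ A + b₂ log(Qu/2π) + b₁ log(Qv/2π)` with
`A = 729/(2048t₀²) + (c−½) log ζ(c) + ∫_c^∞ log ζ + d² log 4 (2ζ'/ζ(1+2d) − ζ'/ζ(½+d) + e_b(t₀))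
+ d² e_a(t₀) − I(d)`. [cite: Trudgian2011, §3.4 Lemmas 3.6–3.7] -/
theorem setIntegral_log_norm_LFunction_sub_le₂ (hq : 1 < q) (hχ : χ.IsPrimitive)
    {c d t₀ u v : ℝ} (hc1 : 1 < c) (hc : c ≤ 5 / 4) (hd : 1 / 2 < d) (hd1 : d ≤ 1) (ht₀ : 1 ≤ t₀)
    (hu : t₀ < u) (hv : t₀ < v)
    (hzu : ∀ ρ ∈ charNontrivialZeros χ, ρ.im ≠ u) (hzv : ∀ ρ ∈ charNontrivialZeros χ, ρ.im ≠ v) :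
    (∫ σ in Ioi (1 / 2 : ℝ), Real.log ‖χ.LFunction (σ + v * I)‖) -
        ∫ σ in Ioi (1 / 2 : ℝ), Real.log ‖χ.LFunction (σ + u * I)‖ ≤
      ((729 / (2048 * t₀ ^ 2) + (c - 1 / 2) * logZeta c + ∫ σ in Ioi c, logZeta σ) +
          (d ^ 2 * Real.log 4 *
              ((2 * (deriv riemannZeta (2 * (1 / 2 + d) : ℝ) / riemannZeta (2 * (1 / 2 + d) : ℝ)).re -
                  (deriv riemannZeta (1 / 2 + d : ℝ) / riemannZeta (1 / 2 + d : ℝ)).re) +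
                (25 / (16 * t₀ ^ 2) + (2 / (3 * t₀ ^ 3) + π / (6 * t₀ ^ 2)))) +
            d ^ 2 * (7 / (4 * t₀ ^ 2) + (2 / (3 * t₀ ^ 3) + π / (6 * t₀ ^ 2))) - turingI d)) +
        d ^ 2 / 2 * (Real.log 4 - 1) * Real.log (q * u / (2 * π)) +
        (c - 1 / 2) ^ 2 / 4 * Real.log (q * v / (2 * π)) := by
  have hqR : (0 : ℝ) < q := by exact_mod_cast (show 0 < q by omega)
  have ht₀0 : 0 < t₀ := by linarith
  have hu1 : 1 ≤ u := by linarith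
  have hu0 : 0 < u := by linarith
  have hv0 : 0 < v := by linarith
  have hU := trudgian2011_lemma36 hq hχ hc1 hc ht₀0 hv hzv
  have hL := neg_setIntegral_log_norm_LFunction_le₂ hq hχ hd hd1 hu1 hzu
  have hεa := err_mono ht₀0 hu.le 7 4 (by norm_num) (by norm_num)
  have hεb := err_mono ht₀0 hu.le 25 16 (by norm_num) (by norm_num)
  have hlog4 : 0 ≤ d ^ 2 * Real.log 4 := by
    have := Real.log_nonneg (by norm_num : (1:ℝ) ≤ 4); positivity
  have hd2 : 0 ≤ d ^ 2 := sq_nonneg d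
  have hm1 := mul_le_mul_of_nonneg_left hεb hlog4
  have hm2 := mul_le_mul_of_nonneg_left hεa hd2
  have hlogu := log_qt_eq₂ hqR hu0
  have hlogv := log_qt_eq₂ hqR hv0
  rw [hlogu, hlogv]
  rw [hlogv] at hU
  have hlog4' : Real.log 4 = 2 * Real.log 2 := by
    rw [show (4 : ℝ) = 2 ^ 2 by norm_num, Real.log_pow]; push_cast; ring
  rw [hlog4'] at hL hm1 hlog4 ⊢
  nlinarith [hU, hL, hm1, hm2, Real.log_pos (by norm_num : (1:ℝ) < 2)]


/-- **Theorem 3.8 for ONE primitive character, second-order error terms, upper side:** for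
`1 < c ≤ 5/4`, `½ < d ≤ 1`, `1 ≤ t₀ < t₁ ≤ t₂`, `t₁`, `t₂` non-ordinates,
`π ∫_{t₁}^{t₂} S(t,χ) dt ≤ A + (b₁ + b₂) log(Qt₂/2π)`. [cite: Trudgian2011, §3.4 Theorem 3.8] -/
theorem pi_mul_integral_lfunctionArgS_le₂ (hq : 1 < q) (hχ : χ.IsPrimitive)
    {c d t₀ t₁ t₂ : ℝ} (hc1 : 1 < c) (hc : c ≤ 5 / 4) (hd : 1 / 2 < d) (hd1 : d ≤ 1) (ht₀ : 1 ≤ t₀)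
    (h01 : t₀ < t₁) (h12 : t₁ ≤ t₂)
    (hz₁ : ∀ ρ ∈ charNontrivialZeros χ, ρ.im ≠ t₁) (hz₂ : ∀ ρ ∈ charNontrivialZeros χ, ρ.im ≠ t₂) :
    π * ∫ t in t₁..t₂, lfunctionArgS χ t ≤
      ((729 / (2048 * t₀ ^ 2) + (c - 1 / 2) * logZeta c + ∫ σ in Ioi c, logZeta σ) +
          (d ^ 2 * Real.log 4 *
              ((2 * (deriv riemannZeta (2 * (1 / 2 + d) : ℝ) / riemannZeta (2 * (1 / 2 + d) : ℝ)).re -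
                  (deriv riemannZeta (1 / 2 + d : ℝ) / riemannZeta (1 / 2 + d : ℝ)).re) +
                (25 / (16 * t₀ ^ 2) + (2 / (3 * t₀ ^ 3) + π / (6 * t₀ ^ 2)))) +
            d ^ 2 * (7 / (4 * t₀ ^ 2) + (2 / (3 * t₀ ^ 3) + π / (6 * t₀ ^ 2))) - turingI d)) +
        ((c - 1 / 2) ^ 2 / 4 + d ^ 2 / 2 * (Real.log 4 - 1)) * Real.log (q * t₂ / (2 * π)) := by
  have hqR : (0 : ℝ) < q := by exact_mod_cast (show 0 < q by omega)
  have ht₁0 : 0 < t₁ := by linarith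
  have h := setIntegral_log_norm_LFunction_sub_le₂ hq hχ hc1 hc hd hd1 ht₀ h01
    (h01.trans_le h12) hz₁ hz₂
  rw [pi_mul_integral_lfunctionArgS_eq hχ hq h12 hz₁ hz₂]
  have hmono : Real.log (q * t₁ / (2 * π)) ≤ Real.log (q * t₂ / (2 * π)) := by
    refine Real.log_le_log (by positivity) ?_
    gcongr
  have hb : 0 ≤ d ^ 2 / 2 * (Real.log 4 - 1) := by
    have : 1 ≤ Real.log 4 := by
      rw [Real.le_log_iff_exp_le (by norm_num)]
      have := Real.exp_one_lt_d9; linarith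
    exact mul_nonneg (by positivity) (by linarith)
  have hm := mul_le_mul_of_nonneg_left hmono hb
  linarith

/-- **Theorem 3.8 for ONE primitive character, second-order error terms, lower side** (roles of
`t₁`, `t₂` reversed). [cite: Trudgian2011, §3.4 Theorem 3.8] -/
theorem neg_pi_mul_integral_lfunctionArgS_le₂ (hq : 1 < q) (hχ : χ.IsPrimitive)
    {c d t₀ t₁ t₂ : ℝ} (hc1 : 1 < c) (hc : c ≤ 5 / 4) (hd : 1 / 2 < d) (hd1 : d ≤ 1) (ht₀ : 1 ≤ t₀)
    (h01 : t₀ < t₁) (h12 : t₁ ≤ t₂)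
    (hz₁ : ∀ ρ ∈ charNontrivialZeros χ, ρ.im ≠ t₁) (hz₂ : ∀ ρ ∈ charNontrivialZeros χ, ρ.im ≠ t₂) :
    -(π * ∫ t in t₁..t₂, lfunctionArgS χ t) ≤
      ((729 / (2048 * t₀ ^ 2) + (c - 1 / 2) * logZeta c + ∫ σ in Ioi c, logZeta σ) +
          (d ^ 2 * Real.log 4 *
              ((2 * (deriv riemannZeta (2 * (1 / 2 + d) : ℝ) / riemannZeta (2 * (1 / 2 + d) : ℝ)).re -
                  (deriv riemannZeta (1 / 2 + d : ℝ) / riemannZeta (1 / 2 + d : ℝ)).re) +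
                (25 / (16 * t₀ ^ 2) + (2 / (3 * t₀ ^ 3) + π / (6 * t₀ ^ 2)))) +
            d ^ 2 * (7 / (4 * t₀ ^ 2) + (2 / (3 * t₀ ^ 3) + π / (6 * t₀ ^ 2))) - turingI d)) +
        ((c - 1 / 2) ^ 2 / 4 + d ^ 2 / 2 * (Real.log 4 - 1)) * Real.log (q * t₂ / (2 * π)) := by
  have hqR : (0 : ℝ) < q := by exact_mod_cast (show 0 < q by omega)
  have ht₁0 : 0 < t₁ := by linarith
  have h := setIntegral_log_norm_LFunction_sub_le₂ hq hχ hc1 hc hd hd1 ht₀ (h01.trans_le h12) h01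
    hz₂ hz₁
  rw [pi_mul_integral_lfunctionArgS_eq hχ hq h12 hz₁ hz₂]
  have hmono : Real.log (q * t₁ / (2 * π)) ≤ Real.log (q * t₂ / (2 * π)) := by
    refine Real.log_le_log (by positivity) ?_
    gcongr
  have hb : 0 ≤ (c - 1 / 2) ^ 2 / 4 := by positivity
  have hm := mul_le_mul_of_nonneg_left hmono hb
  linarith

/-! ### Matching Trudgian's constants `a(c, d, t₀)`, `b(c, d)` ((3.17)–(3.18)) -/

/-- `ζ'/ζ(x) ≤ 0` for real `x > 1` (`−ζ'/ζ(x) = Σ Λ(n) n^{−x} ≥ 0`). [folklore] -/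
private theorem re_logDeriv_zeta_ofReal_nonpos {x : ℝ} (hx : 1 < x) :
    (deriv riemannZeta (x : ℂ) / riemannZeta (x : ℂ)).re ≤ 0 := by
  have h := norm_LSeries_vonMangoldt_le_of_one_lt_re (s := (x : ℂ)) (by simpa using hx)
  have h0 := (norm_nonneg _).trans h
  simp only [ofReal_re] at h0
  rw [neg_div, neg_re] at h0
  linarith

/-- `Re (ζ'(x)/ζ(x)) = Re ζ'(x) / Re ζ(x)` for real `x > 1` (both are real). [folklore] -/
private theorem re_logDeriv_zeta_ofReal_eq {x : ℝ} (hx : 1 < x) :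
    (deriv riemannZeta (x : ℂ) / riemannZeta (x : ℂ)).re =
      (deriv riemannZeta (x : ℂ)).re / (riemannZeta (x : ℂ)).re := by
  have him := riemannZeta_im_eq_zero_of_one_lt hx
  have hre := riemannZeta_re_pos_of_one_lt hx
  have hz : riemannZeta x = (((riemannZeta x).re : ℝ) : ℂ) := by
    apply Complex.ext <;> simp [him]
  rw [hz, Complex.div_ofReal_re]
  simp

/-- `logZeta σ = log ‖ζ(σ)‖` for `σ > 1`. [folklore] -/
private theorem logZeta_eq_log_norm {σ : ℝ} (hσ : 1 < σ) : logZeta σ = Real.log ‖riemannZeta σ‖ := by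
  change Real.log (riemannZeta σ).re = Real.log ‖riemannZeta σ‖
  rw [← Booker2006Turing.bigZ_eq_norm hσ, Booker2006Turing.bigZ]

/-- Trudgian's `I(d)`-integrals in the `logZeta` spelling of (3.17): for `½ < d`,
`−I(d) = −½∫_{2d+1}^∞ log ζ + ∫_{½+d}^∞ log ζ − ½∫_{2d+1}^{4d+1} log ζ + ∫_{½+d}^{½+2d} log ζ`.
[cite: Trudgian2011, §3 Theorem 3.8 (3.17), p. 2273] -/
theorem turingI_eq_logZeta {d : ℝ} (hd : 1 / 2 < d) :
    turingI d =
      1 / 2 * (∫ σ in Ioi (2 * d + 1), logZeta σ) - (∫ σ in Ioi (1 / 2 + d), logZeta σ) +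
        1 / 2 * (∫ σ in (2 * d + 1)..(4 * d + 1), logZeta σ) -
        ∫ σ in (1 / 2 + d)..(1 / 2 + 2 * d), logZeta σ := by
  simp only [turingI]
  have e1 : (1 : ℝ) + 2 * d = 2 * d + 1 := by ring
  have e2 : (1 : ℝ) + 4 * d = 4 * d + 1 := by ring
  rw [e1, e2]
  have hA : ∫ σ in Ioi (2 * d + 1), Real.log ‖riemannZeta σ‖ = ∫ σ in Ioi (2 * d + 1), logZeta σ :=
    setIntegral_congr_fun measurableSet_Ioi fun σ hσ ↦
      (logZeta_eq_log_norm (by simp only [mem_Ioi] at hσ; linarith)).symm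
  have hB : ∫ σ in Ioi (1 / 2 + d), Real.log ‖riemannZeta σ‖ = ∫ σ in Ioi (1 / 2 + d), logZeta σ :=
    setIntegral_congr_fun measurableSet_Ioi fun σ hσ ↦
      (logZeta_eq_log_norm (by simp only [mem_Ioi] at hσ; linarith)).symm
  have hC : ∫ σ in (2 * d + 1)..(4 * d + 1), Real.log ‖riemannZeta σ‖ =
      ∫ σ in (2 * d + 1)..(4 * d + 1), logZeta σ := by
    refine intervalIntegral.integral_congr fun σ hσ ↦ ?_
    rw [uIcc_of_le (by linarith)] at hσ
    exact (logZeta_eq_log_norm (by linarith [hσ.1])).symm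
  have hD : ∫ σ in (1 / 2 + d)..(1 / 2 + 2 * d), Real.log ‖riemannZeta σ‖ =
      ∫ σ in (1 / 2 + d)..(1 / 2 + 2 * d), logZeta σ := by
    refine intervalIntegral.integral_congr fun σ hσ ↦ ?_
    rw [uIcc_of_le (by linarith)] at hσ
    exact (logZeta_eq_log_norm (by linarith [hσ.1])).symm
  rw [hA, hB, hC, hD]

/-- **The error budget `15d²/t₀²` of (3.17) covers the second-order error terms:** for `½ < d`,
`t₀ > 50`, `729/(2048t₀²) + d² log 4 · e_b(t₀) + d² e_a(t₀) ≤ 15d²/t₀²`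
(indeed `≤ 6.7 d²/t₀²`). [cite: Trudgian2011, §3 Theorem 3.8 (3.17), p. 2273] -/
theorem error_le_fifteen {d t₀ : ℝ} (hd : 1 / 2 < d) (ht₀ : 50 < t₀) :
    729 / (2048 * t₀ ^ 2) +
        d ^ 2 * Real.log 4 * (25 / (16 * t₀ ^ 2) + (2 / (3 * t₀ ^ 3) + π / (6 * t₀ ^ 2))) +
        d ^ 2 * (7 / (4 * t₀ ^ 2) + (2 / (3 * t₀ ^ 3) + π / (6 * t₀ ^ 2))) ≤
      15 * d ^ 2 / t₀ ^ 2 := by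
  have ht0 : 0 < t₀ := by linarith
  have ht2 : 0 < t₀ ^ 2 := by positivity
  have hd2 : 1 / 4 < d ^ 2 := by nlinarith
  have hπ := Real.pi_lt_d2
  have hlog4 : Real.log 4 ≤ 3 / 2 := by
    rw [Real.log_le_iff_le_exp (by norm_num)]
    have h1 := Real.exp_one_gt_d9
    have h2 := Real.add_one_le_exp (1 / 2 : ℝ)
    have e : Real.exp (3 / 2 : ℝ) = Real.exp 1 * Real.exp (1 / 2) := by
      rw [← Real.exp_add]; norm_num
    rw [e]
    nlinarith [Real.exp_pos (1 / 2 : ℝ), Real.exp_pos (1 : ℝ)]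
  have hlog0 : 0 ≤ Real.log 4 := Real.log_nonneg (by norm_num)
  -- `2/(3t₀³) ≤ 1/(75 t₀²)`
  have hcube : 2 / (3 * t₀ ^ 3) ≤ 1 / (75 * t₀ ^ 2) := by
    rw [div_le_div_iff₀ (by positivity) (by positivity)]
    nlinarith
  have hB : 25 / (16 * t₀ ^ 2) + (2 / (3 * t₀ ^ 3) + π / (6 * t₀ ^ 2)) ≤ 2.11 / t₀ ^ 2 := by
    have e : (2.11 : ℝ) / t₀ ^ 2 = 25 / (16 * t₀ ^ 2) + 1 / (75 * t₀ ^ 2) + (2.11 - 25 / 16 - 1 / 75) / t₀ ^ 2 := by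
      field_simp; ring
    rw [e]
    have : π / (6 * t₀ ^ 2) ≤ (2.11 - 25 / 16 - 1 / 75) / t₀ ^ 2 := by
      rw [div_le_div_iff₀ (by positivity) ht2]
      nlinarith
    linarith
  have hA : 7 / (4 * t₀ ^ 2) + (2 / (3 * t₀ ^ 3) + π / (6 * t₀ ^ 2)) ≤ 2.3 / t₀ ^ 2 := by
    have e : (2.3 : ℝ) / t₀ ^ 2 = 7 / (4 * t₀ ^ 2) + 1 / (75 * t₀ ^ 2) + (2.3 - 7 / 4 - 1 / 75) / t₀ ^ 2 := by
      field_simp; ring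
    rw [e]
    have : π / (6 * t₀ ^ 2) ≤ (2.3 - 7 / 4 - 1 / 75) / t₀ ^ 2 := by
      rw [div_le_div_iff₀ (by positivity) ht2]
      nlinarith
    linarith
  have h729 : 729 / (2048 * t₀ ^ 2) ≤ 1.5 * d ^ 2 / t₀ ^ 2 := by
    rw [div_le_div_iff₀ (by positivity) ht2]
    nlinarith
  have hd20 : 0 ≤ d ^ 2 := sq_nonneg d
  have h1 : d ^ 2 * Real.log 4 * (25 / (16 * t₀ ^ 2) + (2 / (3 * t₀ ^ 3) + π / (6 * t₀ ^ 2))) ≤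
      d ^ 2 * (3 / 2) * (2.11 / t₀ ^ 2) := by
    have := mul_le_mul (mul_le_mul_of_nonneg_left hlog4 hd20) hB (by positivity) (by positivity)
    exact this
  have h2 : d ^ 2 * (7 / (4 * t₀ ^ 2) + (2 / (3 * t₀ ^ 3) + π / (6 * t₀ ^ 2))) ≤ d ^ 2 * (2.3 / t₀ ^ 2) :=
    mul_le_mul_of_nonneg_left hA hd20
  have e : 1.5 * d ^ 2 / t₀ ^ 2 + d ^ 2 * (3 / 2) * (2.11 / t₀ ^ 2) + d ^ 2 * (2.3 / t₀ ^ 2) =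
      (1.5 + 3 / 2 * 2.11 + 2.3) * d ^ 2 / t₀ ^ 2 := by
    field_simp
  have hfin : (1.5 + 3 / 2 * 2.11 + 2.3) * d ^ 2 / t₀ ^ 2 ≤ 15 * d ^ 2 / t₀ ^ 2 := by
    apply div_le_div_of_nonneg_right _ ht2.le
    nlinarith
  linarith

/-- **The second-order constants are dominated by Trudgian's (3.17)–(3.18):** for `1 < c ≤ 5/4`,
`½ < d ≤ 1`, `t₀ > 50` and every real `L`,
`A + (b₁ + b₂) L ≤ π a(c,d,t₀) + π b(c,d) L` with `A` the second-order constant above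
(`2ζ'/ζ(1+2d) ≤ 0`, `error_le_fifteen`, `turingI_eq_logZeta`, and `(b₁ + b₂) = π b`).
[cite: Trudgian2011, §3 Theorem 3.8 (3.17)–(3.18), p. 2273] -/
theorem secondOrderConst_le_pi_mul_aConst {c d t₀ : ℝ} (hd : 1 / 2 < d) (ht₀ : 50 < t₀) (L : ℝ) :
    ((729 / (2048 * t₀ ^ 2) + (c - 1 / 2) * logZeta c + ∫ σ in Ioi c, logZeta σ) +
          (d ^ 2 * Real.log 4 *
              ((2 * (deriv riemannZeta (2 * (1 / 2 + d) : ℝ) / riemannZeta (2 * (1 / 2 + d) : ℝ)).re -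
                  (deriv riemannZeta (1 / 2 + d : ℝ) / riemannZeta (1 / 2 + d : ℝ)).re) +
                (25 / (16 * t₀ ^ 2) + (2 / (3 * t₀ ^ 3) + π / (6 * t₀ ^ 2)))) +
            d ^ 2 * (7 / (4 * t₀ ^ 2) + (2 / (3 * t₀ ^ 3) + π / (6 * t₀ ^ 2))) - turingI d)) +
        ((c - 1 / 2) ^ 2 / 4 + d ^ 2 / 2 * (Real.log 4 - 1)) * L ≤
      π * aConst c d t₀ + π * bConst c d * L := by
  have hπ := Real.pi_pos
  have ea : π * aConst c d t₀ =
      (c - 1 / 2) * logZeta c + (∫ σ in Ioi c, logZeta σ) -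
        d ^ 2 * Real.log 4 *
          ((deriv riemannZeta ((1 / 2 + d : ℝ) : ℂ)).re / (riemannZeta ((1 / 2 + d : ℝ) : ℂ)).re) -
        1 / 2 * (∫ σ in Ioi (2 * d + 1), logZeta σ) + (∫ σ in Ioi (1 / 2 + d), logZeta σ) -
        1 / 2 * (∫ σ in (2 * d + 1)..(4 * d + 1), logZeta σ) +
        (∫ σ in (1 / 2 + d)..(1 / 2 + 2 * d), logZeta σ) + 15 * d ^ 2 / t₀ ^ 2 := by
    simp only [aConst]
    field_simp
  have eb : π * bConst c d = (c - 1 / 2) ^ 2 / 4 + d ^ 2 / 2 * (Real.log 4 - 1) := by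
    simp only [bConst]
    field_simp
    ring
  rw [ea, eb, turingI_eq_logZeta hd]
  have h2d : 1 < (2 * (1 / 2 + d) : ℝ) := by linarith
  have hZ2 := re_logDeriv_zeta_ofReal_nonpos h2d
  have hZ := re_logDeriv_zeta_ofReal_eq (x := 1 / 2 + d) (by linarith)
  have herr := error_le_fifteen hd ht₀
  have hlog4 : 0 ≤ d ^ 2 * Real.log 4 := by
    have := Real.log_nonneg (by norm_num : (1:ℝ) ≤ 4); positivity
  have hm := mul_le_mul_of_nonneg_left (by linarith [hZ2] :
    2 * (deriv riemannZeta (2 * (1 / 2 + d) : ℝ) / riemannZeta (2 * (1 / 2 + d) : ℝ)).re ≤ 0) hlog4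
  rw [hZ] at *
  nlinarith [hm, herr, hlog4]

/-- **Trudgian 2011, Theorem 3.8, for ONE primitive character, at non-ordinates:** for `χ`
primitive modulo `Q > 1`, `1 < c ≤ 5/4`, `½ < d ≤ 1`, `50 < t₀ < t₁ ≤ t₂` with `t₁`, `t₂`
ordinates of no non-trivial zero of `L(s,χ)`,
`|∫_{t₁}^{t₂} S(t,χ) dt| ≤ a(c,d,t₀) + b(c,d) log(Qt₂/2π)` ((3.17)–(3.18)).
[cite: Trudgian2011, §3 Theorem 3.8, p. 2273] -/
theorem abs_integral_lfunctionArgS_le_aConst_of_ne (hq : 1 < q) (hχ : χ.IsPrimitive)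
    {c d t₀ t₁ t₂ : ℝ} (hc1 : 1 < c) (hc : c ≤ 5 / 4) (hd : 1 / 2 < d) (hd1 : d ≤ 1) (ht₀ : 50 < t₀)
    (h01 : t₀ < t₁) (h12 : t₁ ≤ t₂)
    (hz₁ : ∀ ρ ∈ charNontrivialZeros χ, ρ.im ≠ t₁) (hz₂ : ∀ ρ ∈ charNontrivialZeros χ, ρ.im ≠ t₂) :
    |∫ t in t₁..t₂, lfunctionArgS χ t| ≤ aConst c d t₀ + bConst c d * Real.log (q * t₂ / (2 * π)) := by
  have hπ := Real.pi_pos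
  have ht₀1 : (1 : ℝ) ≤ t₀ := by linarith
  have hup := pi_mul_integral_lfunctionArgS_le₂ hq hχ hc1 hc hd hd1 ht₀1 h01 h12 hz₁ hz₂
  have hlo := neg_pi_mul_integral_lfunctionArgS_le₂ hq hχ hc1 hc hd hd1 ht₀1 h01 h12 hz₁ hz₂
  have hK := secondOrderConst_le_pi_mul_aConst (c := c) hd ht₀ (Real.log (q * t₂ / (2 * π)))
  have habs : π * |∫ t in t₁..t₂, lfunctionArgS χ t| ≤
      π * (aConst c d t₀ + bConst c d * Real.log (q * t₂ / (2 * π))) := by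
    rw [← abs_of_pos hπ, ← abs_mul, abs_of_pos hπ, mul_add, ← mul_assoc]
    exact abs_le.2 ⟨by linarith, by linarith⟩
  exact le_of_mul_le_mul_left habs hπ

/-! ### Extension to ordinates and the discharge -/

/-- Between any two reals there is a height that is the ordinate of no non-trivial zero of
`L(s, χ)` (`χ ≠ 1`). [folklore] -/
private theorem exists_not_ordinate_mem_Ioo₂ (h1 : χ ≠ 1) {a b : ℝ} (hab : a < b) :
    ∃ u ∈ Ioo a b, ∀ ρ ∈ charNontrivialZeros χ, ρ.im ≠ u := by
  set F : Set ℝ := Complex.im '' lfunctionZeroBox χ (max |a| |b|) with hF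
  have hFf : F.Finite := (lfunctionZeroBox_finite h1 _).image _
  obtain ⟨u, huI, huF⟩ := ((Set.Ioo_infinite hab).sdiff hFf).nonempty
  refine ⟨u, huI, fun ρ hρ hρu ↦ huF ⟨ρ, ?_, hρu⟩⟩
  rw [mem_charNontrivialZeros] at hρ
  refine mem_lfunctionZeroBox.2 ⟨hρ.1, hρ.2.1, hρ.2.2, ?_⟩
  rw [hρu, abs_le]
  constructor
  · have : -|a| ≤ a := neg_abs_le a
    linarith [huI.1, le_max_left |a| |b|]
  · linarith [huI.2, le_abs_self b, le_max_right |a| |b|]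

/-- **Trudgian 2011, Theorem 3.8, for ONE primitive character** (no non-ordinate proviso: both
sides are continuous in `t₁`, `t₂` and the non-ordinates are dense): for `χ` primitive modulo
`Q > 1`, `1 < c ≤ 5/4`, `½ < d ≤ 1`, `50 < t₀ < t₁ < t₂`,
`|∫_{t₁}^{t₂} S(t,χ) dt| ≤ a(c,d,t₀) + b(c,d) log(Qt₂/2π)`. [cite: Trudgian2011, §3 Theorem 3.8, p. 2273] -/
theorem abs_integral_lfunctionArgS_le_aConst (hq : 1 < q) (hχ : χ.IsPrimitive)
    {c d t₀ t₁ t₂ : ℝ} (hc1 : 1 < c) (hc : c ≤ 5 / 4) (hd : 1 / 2 < d) (hd1 : d ≤ 1) (ht₀ : 50 < t₀)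
    (h01 : t₀ < t₁) (h12 : t₁ < t₂) :
    |∫ t in t₁..t₂, lfunctionArgS χ t| ≤ aConst c d t₀ + bConst c d * Real.log (q * t₂ / (2 * π)) := by
  have hq1 : q ≠ 1 := by omega
  have h1 : χ ≠ 1 := SelbergDirichlet.ne_one_of_isPrimitive hq1 hχ
  have hqR : (0 : ℝ) < q := by exact_mod_cast (show 0 < q by omega)
  have hS : ∀ a b, IntervalIntegrable (lfunctionArgS χ) volume a b :=
    Booker2006Turing.intervalIntegrable_lfunctionArgS_of_isPrimitive hχ hq
  set A : ℝ := aConst c d t₀ with hA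
  set B : ℝ := bConst c d with hB
  set LQ : ℝ → ℝ := fun u ↦ Real.log (q * u / (2 * π)) with hLQ
  have hLQc : ContinuousOn LQ (Ioi 0) := by
    have hc' : Continuous fun u : ℝ ↦ (q : ℝ) * u / (2 * π) := by fun_prop
    refine hc'.continuousOn.log fun u hu ↦ ?_
    simp only [mem_Ioi] at hu
    positivity
  -- Step A: `t₁` a non-ordinate, `t₂ ≥ t₁` arbitrary
  have stepA : ∀ t₁ t₂ : ℝ, t₀ < t₁ → t₁ ≤ t₂ → (∀ ρ ∈ charNontrivialZeros χ, ρ.im ≠ t₁) →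
      |∫ t in t₁..t₂, lfunctionArgS χ t| ≤ A + B * LQ t₂ := by
    intro t₁ t₂ h01 h12 hz₁
    have ht₂0 : 0 < t₂ := by linarith
    set P : ℝ → ℝ := fun u ↦ ∫ t in t₁..u, lfunctionArgS χ t with hP
    have hPc : Continuous P := intervalIntegral.continuous_primitive hS t₁
    set F : ℝ → ℝ := fun u ↦ |P u| - (A + B * LQ u) with hF
    have hFc : ContinuousAt F t₂ := by
      have h1' : ContinuousAt (fun u ↦ |P u|) t₂ := (hPc.continuousAt).abs
      have h2' : ContinuousAt (fun u ↦ A + B * LQ u) t₂ :=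
        continuousAt_const.add (continuousAt_const.mul (hLQc.continuousAt (Ioi_mem_nhds ht₂0)))
      exact h1'.sub h2'
    by_contra hcon
    have hpos : 0 < F t₂ := by
      simp only [hF, hP]
      linarith
    have hev := hFc.eventually (lt_mem_nhds hpos)
    obtain ⟨δ, hδ, hball⟩ := Metric.eventually_nhds_iff.1 hev
    obtain ⟨u, huI, hzu⟩ := exists_not_ordinate_mem_Ioo₂ h1 (show t₂ < t₂ + δ by linarith)
    have hu : dist u t₂ < δ := by
      rw [Real.dist_eq, abs_lt]; constructor <;> linarith [huI.1, huI.2]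
    have hFu : 0 < F u := hball hu
    have hle := abs_integral_lfunctionArgS_le_aConst_of_ne hq hχ hc1 hc hd hd1 ht₀ h01
      (by linarith [huI.1] : t₁ ≤ u) hz₁ hzu
    simp only [hF, hP, hLQ] at hFu
    linarith
  -- Step B: `t₁` arbitrary
  have ht₁0 : 0 < t₁ := by linarith
  set P₂ : ℝ → ℝ := fun v ↦ ∫ t in t₂..v, lfunctionArgS χ t with hP₂
  have hP₂c : Continuous P₂ := intervalIntegral.continuous_primitive hS t₂
  set G : ℝ → ℝ := fun v ↦ |P₂ v| - (A + B * LQ t₂) with hG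
  have hGc : Continuous G := by
    simp only [hG]
    fun_prop
  by_contra hcon
  have hpos : 0 < G t₁ := by
    simp only [hG, hP₂]
    rw [intervalIntegral.integral_symm t₂ t₁, abs_neg] at hcon
    linarith
  have hev := (hGc.continuousAt (x := t₁)).eventually (lt_mem_nhds hpos)
  obtain ⟨δ, hδ, hball⟩ := Metric.eventually_nhds_iff.1 hev
  obtain ⟨v, hvI, hzv⟩ := exists_not_ordinate_mem_Ioo₂ h1
    (show max t₀ (t₁ - δ) < t₁ from max_lt h01 (by linarith))
  have hv : dist v t₁ < δ := by
    rw [Real.dist_eq, abs_lt]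
    constructor <;> linarith [hvI.1, hvI.2, le_max_right t₀ (t₁ - δ)]
  have hGv : 0 < G v := hball hv
  have hle := stepA v t₂ (lt_of_le_of_lt (le_max_left _ _) hvI.1) (by linarith [hvI.2]) hzv
  rw [intervalIntegral.integral_symm t₂ v, abs_neg] at hle
  simp only [hG, hP₂] at hGv
  linarith

end TuringDirichlet

/-- **Trudgian 2011, Theorem 3.8 holds**: discharge of the named fact `trudgian2011_theorem38` of
`CertifiedDirichletLTuringTrudgian.lean` (for every `1 < c ≤ 5/4`, `½ < d ≤ 1`, `50 < t₀ < t₁ < t₂`,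
verbatim constants (3.17)–(3.18)). [cite: Trudgian2011, §3 Theorem 3.8, p. 2273] -/
theorem trudgian2011_theorem38_holds : trudgian2011_theorem38 := by
  intro q _ hq χ hχ c d t₀ t₁ t₂ hc1 hc hd hd1 ht₀ h01 h12
  exact TuringDirichlet.abs_integral_lfunctionArgS_le_aConst hq hχ hc1 hc hd hd1 ht₀ h01 h12

end Literature.NumberTheory.LFunctions

end
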